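import Mathlib
import Summits.ValiantsHypothesis.ValiantsHypothesis.Theorems.ProofCarryingSymmetryRestorationQPPCCombCalculus

/-!
# Route ProofCarryingSymmetry — crux `RestorationQP`, line `registered`: permutation invariance of combs, as proof DAGs

Necessity of the provability stub T′ (`stub_invarianceProvableQP'`), part 2b.  From the comb
calculus (part 2):

* `Real.combPerm` — `comb a l = comb a l'` for `l ~ l'`, realized at cost `≤ 40·B·(|l|+1)³`
  (selection: bring the first entry of `l` to its place in `l'` by `commutePast`, recurse);
* `Real.combPermHead` — the same for head-accumulated combs `comb x t = comb y t'` whenever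
  `x :: t ~ y :: t'` (the form in which the binarisation of an unbounded fan-in gate appears);
Everything proved, no named facts.
-/

-- single-problem summit: `Summit.ValiantsHypothesis.ValiantsHypothesis.…` is the namespace by design (D-0017)
set_option linter.dupNamespace false

namespace Summit.ValiantsHypothesis.ValiantsHypothesis.Theorems

namespace PCR

open Literature.Computability.AlgebraicComplexity

universe u v w

variable {𝔽 : Type u} {T : Type w} [CommSemiring 𝔽] {S : PISystem 𝔽 T}

/-! ### Cost arithmetic -/

/-- Cost bookkeeping: a reflexivity line fits. [folklore] -/
theorem arith_base (n a B k : ℕ) (ha : a ≤ B) : n + (a + a) ≤ n + 40 * B * (k + 1) ^ 3 := by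
  have h2 : B ≤ B * (k + 1) ^ 3 := Nat.le_mul_of_pos_right _ (Nat.one_le_pow _ _ (by omega))
  nlinarith [h2, ha]

/-- Cost bookkeeping of the recursion step of `combPerm`. [folklore] -/
theorem arith_perm (B k p q s1 s2 : ℕ) (hp : p ≤ k) (hq : q ≤ k) (h1 : s1 ≤ B) (h2 : s2 ≤ B) :
    40 * B * (k + 1) ^ 3 + 24 * B * (p + 1) ^ 2 + 4 * B * q + (s1 + s2) ≤ 40 * B * (k + 1 + 1) ^ 3 := by
  have e1 : 24 * B * (p + 1) ^ 2 ≤ 24 * B * (k + 1) ^ 2 := by gcongr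
  have e2 : 4 * B * q ≤ 4 * B * k := by gcongr
  have key : 40 * (k + 1) ^ 3 + 24 * (k + 1) ^ 2 + 4 * k + 2 ≤ 40 * (k + 1 + 1) ^ 3 := by
    ring_nf; nlinarith [sq_nonneg k]
  have key' := Nat.mul_le_mul_left B key
  nlinarith [e1, e2, key', h1, h2]

/-- Cost bookkeeping of the equal-heads case of `combPermHead`. [folklore] -/
theorem arith_head_eq (n B t : ℕ) : n + 40 * B * (t + 1) ^ 3 ≤ n + 50 * B * (t + 2) ^ 3 := by
  have : 40 * (t + 1) ^ 3 ≤ 50 * (t + 2) ^ 3 := by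
    have h3 : (t + 1) ^ 3 ≤ (t + 2) ^ 3 := Nat.pow_le_pow_left (by omega) 3
    calc 40 * (t + 1) ^ 3 ≤ 40 * (t + 2) ^ 3 := Nat.mul_le_mul_left 40 h3
      _ ≤ 50 * (t + 2) ^ 3 := Nat.mul_le_mul_right _ (by norm_num)
  nlinarith [Nat.mul_le_mul_left B this]

/-- Cost bookkeeping of the distinct-heads case of `combPermHead`. [folklore] -/
theorem arith_head (B t p q s₁ s₂ s₃ s₄ s₅ s₆ s₇ s₈ s₉ s₁₀ : ℕ) (hlen : p + q + 1 = t)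
    (h₁ : s₁ ≤ B) (h₂ : s₂ ≤ B) (h₃ : s₃ ≤ B) (h₄ : s₄ ≤ B) (h₅ : s₅ ≤ B) (h₆ : s₆ ≤ B) (h₇ : s₇ ≤ B)
    (h₈ : s₈ ≤ B) (h₉ : s₉ ≤ B) (h₁₀ : s₁₀ ≤ B) :
    24 * B * (p + 1) ^ 2 + (s₁ + s₂) + 4 * B * p + (s₃ + s₄) + (s₅ + s₆) + 4 * B * q +
      40 * B * (t + 1) ^ 3 + (s₇ + s₈) + (s₉ + s₁₀) ≤ 50 * B * (t + 2) ^ 3 := by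
  have e1 : 24 * B * (p + 1) ^ 2 ≤ 24 * B * (t + 1) ^ 2 := by gcongr; omega
  have e2 : 4 * B * p ≤ 4 * B * t := by gcongr; omega
  have e3 : 4 * B * q ≤ 4 * B * t := by gcongr; omega
  have key : 24 * (t + 1) ^ 2 + 8 * t + 40 * (t + 1) ^ 3 + 10 ≤ 50 * (t + 2) ^ 3 := by
    ring_nf; nlinarith [sq_nonneg t]
  have key' := Nat.mul_le_mul_left B key
  nlinarith [e1, e2, e3, key', h₁, h₂, h₃, h₄, h₅, h₆, h₇, h₈, h₉, h₁₀]

/-! ### Permutations -/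

/-- **Permutation invariance of combs, as a proof DAG.** For `l ~ l'` (and `|l| ≤ k`), the line
`comb a l = comb a l'` is realized at cost `≤ 40·B·(k+1)³`, `B` any bound on the weight `W a l`.
[folklore] -/
theorem Real.combPerm (K : OpKit S) : ∀ (k : ℕ) (l l' : List T) (_ : l.length ≤ k) (_ : l.Perm l')
    {L : List (T × T)} {n : ℕ} (_ : Real S L n) (a : T) {B : ℕ} (_ : W S a l ≤ B),
    Real S ((comb K a l, comb K a l') :: L) (n + 40 * B * (k + 1) ^ 3)
  | 0, l, l', hk, hp, L, n, h, a, B, hB => by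
    have hl : l = [] := List.eq_nil_of_length_eq_zero (Nat.le_zero.1 hk)
    subst hl
    have hl' : l' = [] := (List.Perm.nil_eq hp).symm
    subst hl'
    have ha : S.size a ≤ B := by simpa using hB
    simpa using (h.refl a).mono (List.Subset.refl _) (arith_base n _ B 0 ha)
  | k + 1, [], l', _, hp, L, n, h, a, B, hB => by
    have hl' : l' = [] := (List.Perm.nil_eq hp).symm
    subst hl'
    have ha : S.size a ≤ B := by simpa using hB
    simpa using (h.refl a).mono (List.Subset.refl _) (arith_base n _ B (k + 1) ha)
  | k + 1, x :: t, l', hk, hp, L, n, h, a, B, hB => by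
    have hx : x ∈ l' := hp.subset List.mem_cons_self
    obtain ⟨p, q, rfl⟩ := List.append_of_mem hx
    have ht : t.Perm (p ++ q) := (hp.trans List.perm_middle).cons_inv
    have htk : t.length ≤ k := by simpa using hk
    -- weights
    have hWl' : W S a (p ++ x :: q) = W S a (x :: t) := (W_perm a hp).symm
    have hW1 : W S (K.op a x) t ≤ B := by rw [W_op]; exact hB
    have hW2 : W S a (x :: p) ≤ B := by
      calc W S a (x :: p) ≤ W S a (x :: p ++ q) := W_le_W_append a (x :: p) q
        _ = W S a (p ++ x :: q) := (W_middle a x p q).symm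
        _ ≤ B := by rw [hWl']; exact hB
    have hW3 : W S (comb K (K.op a x) p) q ≤ B := by
      have e : W S (comb K (K.op a x) p) q = W S a (p ++ x :: q) := by
        unfold W; rw [size_comb, W_op, W_cons]; simp [List.sum_append]; ring
      rw [e, hWl']; exact hB
    have hW4 : W S (K.op (comb K a p) x) q ≤ B := by
      have e : W S (K.op (comb K a p) x) q = W S a (p ++ x :: q) := by
        unfold W; rw [K.size_op, size_comb]; unfold W; simp [List.sum_append]; ring
      rw [e, hWl']; exact hB
    have hsz1 : S.size (comb K (K.op a x) t) ≤ B := by rw [size_comb]; exact hW1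
    have hsz2 : S.size (comb K (K.op (comb K a p) x) q) ≤ B := by rw [size_comb]; exact hW4
    -- 1: recursion on `t ~ p ++ q` with accumulator `a ∘ x`
    have r1 := Real.combPerm K k t (p ++ q) htk ht h (K.op a x) hW1
    rw [comb_append] at r1
    -- 2: commute `x` past `p`; 3: lift through `q`; 4: chain
    have r2 := r1.commutePast K p a x hW2
    have r3 := r2.combCongrAcc K q List.mem_cons_self hW3 hW4
    have r4 := r3.trans (List.mem_cons_of_mem _ (List.mem_cons_of_mem _ List.mem_cons_self))
      List.mem_cons_self
    have e1 : comb K (K.op (comb K a p) x) q = comb K a (p ++ x :: q) := by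
      rw [comb_append, comb_cons]
    rw [e1] at r4
    refine r4.mono (List.cons_subset_cons _ fun e he => ?_) ?_
    · exact List.mem_cons_of_mem _ (List.mem_cons_of_mem _ (List.mem_cons_of_mem _ he))
    · have hp' : p.length ≤ k := by
        have := hp.length_eq; simp at this; omega
      have hq' : q.length ≤ k := by
        have := hp.length_eq; simp at this; omega
      rw [e1] at hsz2
      have := arith_perm B k p.length q.length _ _ hp' hq' hsz1 hsz2
      linarith

/-- **Permutation invariance of head-accumulated combs.** If `x :: t ~ y :: t'` then the line
`comb x t = comb y t'` is realized at cost `≤ 50·B·(|t|+2)³`, `B` any bound on the weight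
`W x t`. [folklore] -/
theorem Real.combPermHead (K : OpKit S) {L : List (T × T)} {n : ℕ} (h : Real S L n) {x y : T}
    {t t' : List T} (hp : (x :: t).Perm (y :: t')) {B : ℕ} (hB : W S x t ≤ B) :
    Real S ((comb K x t, comb K y t') :: L) (n + 50 * B * (t.length + 2) ^ 3) := by
  by_cases hxy : x = y
  · subst hxy
    have r := Real.combPerm K t.length t t' le_rfl hp.cons_inv h x hB
    exact r.mono (List.Subset.refl _) (arith_head_eq n B t.length)
  · have hx : x ∈ t' := by
      have := hp.subset (List.mem_cons_self); simpa [hxy] using this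
    obtain ⟨p, q, rfl⟩ := List.append_of_mem hx
    -- `t ~ y :: (p ++ q)`
    have hperm : (x :: t).Perm (x :: y :: (p ++ q)) :=
      hp.trans ((List.perm_middle.cons y).trans (List.Perm.swap x y (p ++ q)))
    have ht : t.Perm (y :: (p ++ q)) := hperm.cons_inv
    -- weights: everything weighs `W x t ≤ B`
    have hWt : W S x (y :: (p ++ q)) ≤ B := by rw [← W_perm x ht]; exact hB
    have hW1 : W S y (x :: p) ≤ B := by
      have e : W S y (x :: p) = W S x (y :: p) := by simp only [W_cons]; ring
      rw [e]
      calc W S x (y :: p) ≤ W S x (y :: p ++ q) := W_le_W_append x (y :: p) q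
        _ ≤ B := hWt
    have hW2 : W S (K.op y x) p ≤ B := by rw [W_op]; exact hW1
    have hW3 : W S (K.op x y) p ≤ B := by
      rw [W_op]; exact (W_le_W_append x (y :: p) q).trans hWt
    have hW4 : W S (K.op (comb K y p) x) q ≤ B := by
      have e : W S (K.op (comb K y p) x) q = W S x (y :: (p ++ q)) := by
        unfold W; rw [K.size_op, size_comb]; unfold W; simp [List.sum_append]; ring
      rw [e]; exact hWt
    have hW5 : W S (comb K x (y :: p)) q ≤ B := by
      have e : W S (comb K x (y :: p)) q = W S x (y :: (p ++ q)) := by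
        unfold W; rw [size_comb]; unfold W; simp [List.sum_append]; ring
      rw [e]; exact hWt
    have hs1 : S.size (K.op y x) ≤ B := (size_le_W (S := S) _ p).trans hW2
    have hs2 : S.size (K.op x y) ≤ B := (size_le_W (S := S) _ p).trans hW3
    have hs3 : S.size (K.op (comb K y p) x) ≤ B := (size_le_W (S := S) _ q).trans hW4
    have hs4 : S.size (comb K (K.op x y) p) ≤ B := by rw [size_comb]; exact hW3
    have hs5 : S.size (comb K x t) ≤ B := by rw [size_comb]; exact hB
    have hs6 : S.size (comb K (comb K x (y :: p)) q) ≤ B := by rw [size_comb]; exact hW5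
    have hs7 : S.size (comb K (K.op y x) p) ≤ B := by rw [size_comb]; exact hW2
    have hs8 : S.size (comb K x (y :: (p ++ q))) ≤ B := by rw [size_comb]; exact hWt
    have hs9 : S.size (comb K y (p ++ x :: q)) ≤ B := by
      have e : W S y (p ++ x :: q) = W S x (y :: (p ++ q)) := by
        simp [W]; omega
      rw [size_comb, e]; exact hWt
    -- 1: commute `x` past `p` under accumulator `y`:  (comb (y∘x) p, (comb y p) ∘ x)
    have r1 := h.commutePast K p y x hW1
    -- 2: (y∘x, x∘y);  3: lift through `p`: (comb (y∘x) p, comb (x∘y) p)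
    obtain ⟨s, hax⟩ := K.comm y x
    have r2 := r1.axm hax
    have r3 := r2.combCongrAcc K p List.mem_cons_self hW2 hW3
    -- 4: ((comb y p) ∘ x, comb (y∘x) p) ; 5: ((comb y p) ∘ x, comb (x∘y) p)
    have r4 := r3.symm (List.mem_cons_of_mem _ (List.mem_cons_of_mem _ List.mem_cons_self))
    have r5 := r4.trans List.mem_cons_self (List.mem_cons_of_mem _ List.mem_cons_self)
    -- 6: lift through `q`: (comb ((comb y p) ∘ x) q, comb (comb (x∘y) p) q) = (comb y t', comb x (y :: p ++ q))
    have r6 := r5.combCongrAcc K q List.mem_cons_self hW4 (by simpa using hW5)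
    have e1 : comb K (K.op (comb K y p) x) q = comb K y (p ++ x :: q) := by rw [comb_append, comb_cons]
    have e2 : comb K (comb K (K.op x y) p) q = comb K x (y :: (p ++ q)) := by
      rw [comb_cons, comb_append]
    rw [e1, e2] at r6
    -- 7: (comb x t, comb x (y :: (p ++ q))) by permutation with accumulator `x`; 8: symm 6; 9: chain
    have r7 := Real.combPerm K t.length t (y :: (p ++ q)) le_rfl ht r6 x hB
    have r8 := r7.symm (List.mem_cons_of_mem _ List.mem_cons_self)
    have r9 := r8.trans (List.mem_cons_of_mem _ List.mem_cons_self) List.mem_cons_self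
    refine r9.mono (List.cons_subset_cons _ fun e he => ?_) ?_
    · exact List.mem_cons_of_mem _ (List.mem_cons_of_mem _ (List.mem_cons_of_mem _
        (List.mem_cons_of_mem _ (List.mem_cons_of_mem _ (List.mem_cons_of_mem _
        (List.mem_cons_of_mem _ (List.mem_cons_of_mem _ he)))))))
    · have hlen : p.length + q.length + 1 = t.length := by
        have := hp.length_eq; simp at this; omega
      have := arith_head B t.length p.length q.length _ _ _ _ _ _ _ _ _ _ hlen
        hs1 hs2 hs3 hs7 hs3 hs4 hs8 hs9 hs5 hs9
      linarith


end PCR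

open Literature.Computability.AlgebraicComplexity in
/-- **Permutation invariance of left `+`-combs in `P_c(ℂ)`, as a proof DAG** (registered helper
toward the necessity of stub T′ `stub_invarianceProvableQP'`, crux `RestorationQP`): if
`x :: t ~ y :: t'` then inside any proof DAG the line `foldl (+) x t = foldl (+) y t'` is realized
at cost `≤ 50·B·(|t|+2)³` for any `B ≥ |x| + Σ_{z ∈ t} (|z| + 1)`. [folklore] -/
theorem invarianceProvableQP_aux_combPermHead : ∀ (n : ℕ) (L : List (PICircuit ℂ (Fin n × Fin n) × PICircuit ℂ (Fin n × Fin n))) (m : ℕ) (x y : PICircuit ℂ (Fin n × Fin n)) (t t' : List (PICircuit ℂ (Fin n × Fin n))) (B : ℕ), PCR.Real (pcSystem ℂ (Fin n × Fin n)) L m → (x :: t).Perm (y :: t') → x.size + (t.map fun z => z.size + 1).sum ≤ B → PCR.Real (pcSystem ℂ (Fin n × Fin n)) ((t.foldl PICircuit.add x, t'.foldl PICircuit.add y) :: L) (m + 50 * B * (t.length + 2) ^ 3) := by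
  intro n L m x y t t' B h hp hB
  exact h.combPermHead (PCR.addKit ℂ (Fin n × Fin n)) hp hB

end Summit.ValiantsHypothesis.ValiantsHypothesis.Theorems
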